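import Mathlib
import Literature.NumberTheory.GaloisRepresentations.NormalSubgroupsGL2
import Literature.NumberTheory.EllipticCurves.ModularCurveGammaIndex
import HarnessLib

/-!
# The Goursat index dichotomy in `PGL₂(𝔽_ℓ) × PGL₂(𝔽_ℓ)` (`ℓ ≥ 5` prime)

Stub `stub_goursatIndexDichotomy` (kernel O3', the group theory behind the INDEX PRINCIPLE of the
crux's Disproof §3 F9) of line `SketchIdeator5` of crux U
`Summit.ABC.ABC.Theses.IsogenyGlueCongruence.EllipticGluingPrimeBound` (stmt-ABC-13919).

**Statement.** Let `ℓ ≥ 5` be prime, `P := GL₂(ℤ/ℓ) ⧸ Z(GL₂(ℤ/ℓ)) = PGL₂(𝔽_ℓ)` and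
`H ≤ P × P` a subgroup with full second projection. Then either

* for every `φ ∈ P` the "twisted diagonal" `D_φ = {(a, φ a φ⁻¹)}` meets `H` in a subgroup of
  index `≥ ℓ(ℓ² - 1)/2 = |PSL₂(𝔽_ℓ)|` in `H`, or
* `H` is the graph of a homomorphism `ψ : pr₁(H) → P`.

**Proof (Goursat + Artin).** Let `N₂ := {b | (1, b) ∈ H}` (Mathlib's `H.goursatSnd`); it is
normal in `P` because `pr₂(H) = P`, so its preimage `Ñ ⊴ GL₂(ℤ/ℓ)` is normal, and by Artin's
theorem (the tree's `toGL_range_le_or_le_center_of_normal_zmod`) either `Ñ ⊇ SL₂(ℤ/ℓ)` or `Ñ`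
is central. If `Ñ` is central then `N₂ = ⊥`, i.e. `H` meets every vertical line at most once,
and `H` is the graph of a homomorphism on `pr₁(H)` (second disjunct). If `Ñ ⊇ SL₂(ℤ/ℓ)`, then
`N₂` contains the image of `SL₂(ℤ/ℓ)` in `P`, of order `|SL₂(ℤ/ℓ)| / |{±1}| ≥ ℓ(ℓ² - 1)/2`
(the kernel of `SL₂ → P` is `Z(SL₂) ≅ μ₂`, of order `≤ 2`; `|SL₂(ℤ/ℓ)| = ℓ(ℓ² - 1)` is the
tree's `card_specialLinearGroup_zmod`), and `b ↦ (1, b)` injects `N₂` into `H ⧸ (H ∩ D_φ)`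
because `(1, b) ∈ D_φ` forces `b = φ 1 φ⁻¹ = 1` (first disjunct).
Mathlib + two proved tree theorems; no cited facts.
-/

-- `Summit.<Summit>.<Problem>` is the mandated summit-side namespace (CONVENTIONS §2); for the
-- single-conjunct summit `ABC` the two coincide, so the duplicate `ABC.ABC` is deliberate.
set_option linter.dupNamespace false

namespace Summit.ABC.ABC.Theorems.GluingSlices

open Matrix Matrix.SpecialLinearGroup
open scoped MatrixGroups

/-! ### Pure group theory: subgroups of a product `A × B` -/

section GroupTheory

variable {A B : Type*} [Group A] [Group B]

/-- A subgroup `I ≤ A × B` with `pr₂(I) = ⊤` surjects onto the second factor (the form of the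
hypothesis used by Mathlib's `Subgroup.normal_goursatSnd`). -/
theorem snd_comp_subtype_surjective_of_map_snd_eq_top {I : Subgroup (A × B)}
    (hI : I.map (MonoidHom.snd A B) = ⊤) : Function.Surjective (Prod.snd ∘ I.subtype) := by
  intro b
  have hb : b ∈ I.map (MonoidHom.snd A B) := hI ▸ Subgroup.mem_top b
  obtain ⟨x, hx, rfl⟩ := Subgroup.mem_map.mp hb
  exact ⟨⟨x, hx⟩, rfl⟩

/-- Vertical line test: if `I.goursatSnd = {b | (1, b) ∈ I}` is trivial, then two elements of `I`
with the same first coordinate are equal. -/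
theorem snd_eq_snd_of_goursatSnd_eq_bot {I : Subgroup (A × B)} (hI : I.goursatSnd = ⊥)
    {x y : A × B} (hx : x ∈ I) (hy : y ∈ I) (h : x.1 = y.1) : x.2 = y.2 := by
  have hmem : x⁻¹ * y ∈ I := I.mul_mem (I.inv_mem hx) hy
  have hxy : x⁻¹ * y = (1, x.2⁻¹ * y.2) := Prod.ext (by simp [h]) (by simp)
  rw [hxy, ← Subgroup.mem_goursatSnd, hI, Subgroup.mem_bot, inv_mul_eq_one] at hmem
  exact hmem

/-- If `I.goursatSnd` is trivial, then `I ≤ A × B` is the graph of a homomorphism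
`ψ : pr₁(I) → B`. -/
theorem exists_monoidHom_graph_of_goursatSnd_eq_bot {I : Subgroup (A × B)}
    (hI : I.goursatSnd = ⊥) :
    ∃ ψ : I.map (MonoidHom.fst A B) →* B,
      ∀ x, x ∈ I ↔ ∃ hx : x.1 ∈ I.map (MonoidHom.fst A B), x.2 = ψ ⟨x.1, hx⟩ := by
  have hmem : ∀ a : I.map (MonoidHom.fst A B), ∃ y ∈ I, y.1 = (a : A) := fun a ↦ by
    obtain ⟨y, hy, hya⟩ := Subgroup.mem_map.mp a.2
    exact ⟨y, hy, hya⟩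
  choose y hyI hy1 using hmem
  have huniq := fun (x z : A × B) (hx : x ∈ I) (hz : z ∈ I) (h : x.1 = z.1) ↦
    snd_eq_snd_of_goursatSnd_eq_bot hI hx hz h
  refine ⟨{ toFun := fun a ↦ (y a).2
            map_one' := ?_
            map_mul' := ?_ }, ?_⟩
  · exact (huniq 1 (y 1) I.one_mem (hyI 1) (by simp [hy1])).symm
  · intro a b
    exact huniq (y (a * b)) (y a * y b) (hyI _) (I.mul_mem (hyI a) (hyI b)) (by simp [hy1])
  · intro x
    constructor
    · intro hx
      exact ⟨Subgroup.mem_map_of_mem _ hx, huniq x (y _) hx (hyI _) (by simp [hy1])⟩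
    · rintro ⟨hx, h2⟩
      have hxy : x = y ⟨x.1, hx⟩ := Prod.ext (hy1 ⟨x.1, hx⟩).symm h2
      rw [hxy]
      exact hyI _

/-- Index principle: for `I ≤ P × P` (finite `P`) and `φ ∈ P`, the map `b ↦ (1, b)` injects
`I.goursatSnd` into `I ⧸ (I ∩ D_φ)`, where `D_φ = {(a, φ a φ⁻¹)}` is the twisted diagonal, so
`|I.goursatSnd| ≤ [I : I ∩ D_φ]`. -/
theorem card_goursatSnd_le_relIndex {P : Type*} [Group P] [Finite P] (I : Subgroup (P × P))
    (φ : P) :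
    Nat.card I.goursatSnd ≤
      (I ⊓ ((MonoidHom.id P).prod (MulAut.conj φ).toMonoidHom).range).relIndex I := by
  set K := I ⊓ ((MonoidHom.id P).prod (MulAut.conj φ).toMonoidHom).range
  have hmemI : ∀ b : I.goursatSnd, ((1 : P), (b : P)) ∈ I := fun b ↦
    Subgroup.mem_goursatSnd.mp b.2
  rw [Subgroup.relIndex, Subgroup.index]
  refine Nat.card_le_card_of_injective
    (fun b : I.goursatSnd ↦ (QuotientGroup.mk ⟨((1 : P), (b : P)), hmemI b⟩ : I ⧸ K.subgroupOf I))
    ?_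
  intro b c hbc
  have h := QuotientGroup.eq.mp hbc
  rw [Subgroup.mem_subgroupOf] at h
  obtain ⟨-, a, ha⟩ := h
  have h1 := congrArg Prod.fst ha
  have h2 := congrArg Prod.snd ha
  simp only [MulEquiv.toMonoidHom_eq_coe, MonoidHom.prod_apply, MonoidHom.id_apply,
    MonoidHom.coe_coe, MulAut.conj_apply, Subgroup.coe_mul, InvMemClass.coe_inv, Prod.inv_mk,
    inv_one, Prod.mk_mul_mk, mul_one] at h1 h2
  rw [h1, mul_one, mul_inv_cancel, eq_comm, inv_mul_eq_one] at h2
  exact Subtype.ext h2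

end GroupTheory

/-! ### The `GL₂(ℤ/ℓ)` input: the image of `SL₂(ℤ/ℓ)` in `PGL₂(𝔽_ℓ)` -/

/-- `|SL₂(ℤ/ℓ)| = ℓ (ℓ² - 1)` for a prime `ℓ` (the tree's `card_specialLinearGroup_zmod` at a
prime level). -/
theorem card_specialLinearGroup_zmod_prime (ℓ : ℕ) [hℓ : Fact ℓ.Prime] :
    Nat.card SL(2, ZMod ℓ) = ℓ * (ℓ ^ 2 - 1) := by
  rw [Literature.NumberTheory.EllipticCurves.ModularForms.card_specialLinearGroup_zmod,
    hℓ.out.factorization, Finsupp.prod, Finsupp.support_single _ one_ne_zero,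
    Finset.prod_singleton, Finsupp.single_eq_same]
  have hsq : ℓ ^ 2 - 1 = (ℓ + 1) * (ℓ - 1) := by
    obtain ⟨k, rfl⟩ : ∃ k, ℓ = k + 1 := ⟨ℓ - 1, by have := hℓ.out.pos; omega⟩
    rw [Nat.add_sub_cancel]
    exact Nat.sub_eq_of_eq_add (by ring)
  simp [hsq]

/-- If a subgroup `N` of `PGL₂(𝔽_ℓ) = GL₂(ℤ/ℓ) ⧸ Z` contains the image of `SL₂(ℤ/ℓ)`, then
`|SL₂(ℤ/ℓ)| ≤ 2 |N|`: the kernel of `SL₂(ℤ/ℓ) → PGL₂(𝔽_ℓ)` is `Z(SL₂(ℤ/ℓ)) ≅ μ₂(ℤ/ℓ)`, of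
order at most `2`. -/
theorem card_specialLinearGroup_le_two_mul_card {ℓ : ℕ} [Fact ℓ.Prime]
    (N : Subgroup (GL (Fin 2) (ZMod ℓ) ⧸ Subgroup.center (GL (Fin 2) (ZMod ℓ))))
    (hN : (toGL : SL(2, ZMod ℓ) →* GL (Fin 2) (ZMod ℓ)).range ≤
      N.comap (QuotientGroup.mk' (Subgroup.center (GL (Fin 2) (ZMod ℓ))))) :
    Nat.card SL(2, ZMod ℓ) ≤ 2 * Nat.card N := by
  set θ : SL(2, ZMod ℓ) →* GL (Fin 2) (ZMod ℓ) ⧸ Subgroup.center (GL (Fin 2) (ZMod ℓ)) :=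
    (QuotientGroup.mk' (Subgroup.center (GL (Fin 2) (ZMod ℓ)))).comp toGL with hθ
  have hrange : θ.range ≤ N := by
    rintro _ ⟨s, rfl⟩
    exact hN ⟨s, rfl⟩
  have hker : θ.ker ≤ Subgroup.center SL(2, ZMod ℓ) := fun s hs ↦ by
    rw [MonoidHom.mem_ker, hθ, MonoidHom.comp_apply, QuotientGroup.mk'_apply,
      QuotientGroup.eq_one_iff] at hs
    exact (toGL_mem_center_iff s).mp hs
  have hcardker : Nat.card θ.ker ≤ 2 :=
    calc Nat.card θ.ker ≤ Nat.card (Subgroup.center SL(2, ZMod ℓ)) := Subgroup.card_le_of_le hker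
      _ = Nat.card (rootsOfUnity (Fintype.card (Fin 2)) (ZMod ℓ)) :=
          Nat.card_congr (center_equiv_rootsOfUnity' (0 : Fin 2)).toEquiv
      _ ≤ Fintype.card (Fin 2) := card_rootsOfUnity _ _
      _ = 2 := Fintype.card_fin 2
  calc Nat.card SL(2, ZMod ℓ) = Nat.card θ.ker * Nat.card θ.range := by
        rw [← Subgroup.index_ker, Subgroup.card_mul_index]
    _ ≤ 2 * Nat.card N := Nat.mul_le_mul hcardker (Subgroup.card_le_of_le hrange)

/-! ### The dichotomy -/

/-- **(O3') Goursat index dichotomy.** For a prime `ℓ ≥ 5` and a subgroup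
`H ≤ PGL₂(𝔽_ℓ) × PGL₂(𝔽_ℓ)` with full second projection, either every twisted diagonal
`D_φ = {(a, φ a φ⁻¹)}` meets `H` with index `[H : H ∩ D_φ] ≥ ℓ(ℓ² - 1)/2`, or `H` is the graph of
a homomorphism on its first projection.
Registered stub `stub_goursatIndexDichotomy` of line `SketchIdeator5` (signature verbatim). -/
theorem stub_goursatIndexDichotomy :
    ∀ (ℓ : ℕ) [Fact ℓ.Prime], 5 ≤ ℓ →
      ∀ H : Subgroup ((GL (Fin 2) (ZMod ℓ) ⧸ Subgroup.center (GL (Fin 2) (ZMod ℓ))) ×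
          (GL (Fin 2) (ZMod ℓ) ⧸ Subgroup.center (GL (Fin 2) (ZMod ℓ)))),
        Subgroup.map (MonoidHom.snd _ _) H = ⊤ →
        (∀ φ : GL (Fin 2) (ZMod ℓ) ⧸ Subgroup.center (GL (Fin 2) (ZMod ℓ)),
            ℓ * (ℓ ^ 2 - 1) / 2 ≤
              (H ⊓ ((MonoidHom.id _).prod (MulAut.conj φ).toMonoidHom).range).relIndex H) ∨
        (∃ ψ : Subgroup.map (MonoidHom.fst _ _) H →*
            GL (Fin 2) (ZMod ℓ) ⧸ Subgroup.center (GL (Fin 2) (ZMod ℓ)),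
          ∀ x, x ∈ H ↔ ∃ hx : x.1 ∈ Subgroup.map (MonoidHom.fst _ _) H, x.2 = ψ ⟨x.1, hx⟩) := by
  intro ℓ hℓ h5 H hH
  -- `N₂ = {b | (1, b) ∈ H}` is normal in `P`, so its preimage `Ñ` in `GL₂(ℤ/ℓ)` is normal
  haveI hN₂ : H.goursatSnd.Normal :=
    Subgroup.normal_goursatSnd (snd_comp_subtype_surjective_of_map_snd_eq_top hH)
  set π := QuotientGroup.mk' (Subgroup.center (GL (Fin 2) (ZMod ℓ)))
  haveI : (H.goursatSnd.comap π).Normal := inferInstance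
  -- Artin: `Ñ ⊇ SL₂(ℤ/ℓ)` or `Ñ` is central
  rcases Literature.NumberTheory.GaloisRepresentations.toGL_range_le_or_le_center_of_normal_zmod
      h5 (H.goursatSnd.comap π) with hSL | hZ
  · -- `Ñ ⊇ SL₂`: the index principle
    left
    intro φ
    apply Nat.div_le_of_le_mul
    calc ℓ * (ℓ ^ 2 - 1) = Nat.card SL(2, ZMod ℓ) := (card_specialLinearGroup_zmod_prime ℓ).symm
      _ ≤ 2 * Nat.card H.goursatSnd := card_specialLinearGroup_le_two_mul_card _ hSL
      _ ≤ 2 * _ := Nat.mul_le_mul_left 2 (card_goursatSnd_le_relIndex H φ)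
  · -- `Ñ` central: `N₂ = ⊥` and `H` is a graph
    right
    refine exists_monoidHom_graph_of_goursatSnd_eq_bot ?_
    rw [eq_bot_iff]
    intro b hb
    obtain ⟨g, rfl⟩ := QuotientGroup.mk_surjective b
    have hg : g ∈ H.goursatSnd.comap π := hb
    rw [Subgroup.mem_bot]
    exact (QuotientGroup.eq_one_iff g).mpr (hZ hg)

end Summit.ABC.ABC.Theorems.GluingSlices
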